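import Mathlib
import Literature.Analysis.FluidPDE.NSWave0
import Literature.Analysis.FluidPDE.ClassicalSolution
import Literature.Claims.NS.ClayVariants
import HarnessLib

/-!
# Claim skeleton (D-0090 NS-CLAIMS): A. Shlapunov, N. Tarkhanov, "Existence theorems for regular
solutions to the Cauchy problem for the Navier–Stokes equations in ℝ³", arXiv:2009.10530 **v2** (2020),
51 pp.; v3 (13 Sep 2021) = withdrawal stub, arXiv comment «A significant gap in the proof has been
found» (the authors; same comment on the periodic companion arXiv:2007.14911 v3).
[claim: ShlapunovTarkhanov2020NSR3Withdrawn, status: disputed]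

This file TYPES the paper's claimed theorems and the steps of the printed proof as `Prop`-valued
definitions. NOTHING HERE IS ASSERTED: no axiom, no `sorry`; every displayed statement is the
AUTHORS' CLAIM. The verdict (refuter / referee seats) is recorded in
`run/shared/lean/pub/ns-claims/WHERE-PROOFS-BREAK.md`, never in this file.

WHAT THIS IS NOT: not a claim about NS regularity or blow-up; not a claim about any author beyond the
typed locator.

## The paper's architecture (pp. 28–48) and the ORDERED STEP INDEX

The function spaces of the paper (§1, pp. 3–11: the weighted Bochner–Sobolev scale
`𝔅^{k,2s,s}_vel(I,ℝ³)`, `𝔅^{k+1,2(s−1),s−1}_pre`, `𝔅^{k,2(s−1),s−1}_for`, `H_{2s+k}`, `I = [0,T]`) are NOT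
constructed here (8 pages of weighted norms). Following the cell's typing hygiene (abstract theorem
over Banach spaces + the NS instantiation as a separate predicate), the §2/§4 statements are typed
over an ABSTRACT pair of real normed spaces `X` (standing for `𝔅_vel × 𝔅_pre`) and `Y` (standing for
`𝔅_for × H_{2s+k}`), a map `A : X → Y` (the Navier–Stokes map (2.59), `A(u,p) = (f,u₀)`), and a
"velocity read-out" `vel : X → ℝ → ℝ³ → ℝ³` (the velocity field of a domain element); the predicate
`IsNSDataMap` says that `A` IS the NS data map for viscosity `μ` on `[0,T]`. The decisive §3 inequality
is typed at the grain where it lives: real numbers (`Ineq313Inference`).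

* Step 1 = `Theorem211 A` (Thm 2.11, p. 28): `A` is continuous, injective and OPEN (implicit function
  theorem at every point; classical local theory in the scale).
* Step 2 = `Corollary212 A` (Cor. 2.12, p. 28): the range of `A` is closed iff it is everything
  (clopen subsets of a connected space) — PROVED here from Step 1's openness
  (`corollary212_of_isOpenMap`), i.e. kernel-discharged modulo Step 1.
* Step 3 = `Theorem31 T A vel r` (Thm 3.1, p. 29 — THE LOAD-BEARING LEMMA): if `S ⊆ X` has precompact
  image `A(S)` then the velocities of `S` are bounded in `C(I, L^r(ℝ³))`, `r > 3`. Printed proof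
  pp. 29–38: Lemma 3.2 (energy estimate, p. 29), Lemma 3.3 (p. 30), Lemma 3.4 = (3.10) (p. 32, an
  `L^{2r}` energy-type inequality with a free parameter `Q > 0`), Lemma 3.5 (p. 33, Sobolev), then
  (p. 34 l. 1–9) "energy type inequality (3.10) implies (3.13)", a weighted summation over
  `r_j = 3 r_{j−1}` (3.14), interpolation (3.15)–(3.18), the choice `Q = 2` (3.19)–(3.21) and the
  contradiction `1 ≤ 0` (3.22).
* Step 3a = `Ineq313Inference` (p. 34, "(3.10) implies (3.13)") — the REAL-NUMBER inference by which
  (3.13) is obtained from (3.10): taking `2r_j`-th roots of (3.10) term by term, the data terms become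
  `R_j(f,u₀,Q)` (their `2r_j`-th roots, as printed) but the coefficient `1/(10²Q)` of the `u`-terms
  is KEPT instead of becoming `(10²Q)^{−1/(2r_j)}`; typed verbatim as an implication between
  nonnegative reals (abstract grain, F15).
* Step 4 = `ClosedRangeOfTheorem31 T A vel` (§4, Lemmas 4.2–4.5 and Cor. 4.6, pp. 39–47): the
  `C(I,L^r)` bound of Step 3 (Prodi–Serrin-type regularity criteria in the scale) makes the range of
  `A` closed.
* Step 5 = `Theorem41 A` (Thm 4.1, p. 39 — the paper's MAIN THEOREM): for each `T > 0` (and all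
  `k`, `s`) the map `A` is a homeomorphism. `theorem41_of_steps` PROVES Step 1 → Step 3 → Step 4 →
  Step 5 (pure logic + Step 2).
* Step 6 = `Corollary48 μ` (Cor. 4.8, p. 48, via Thm 4.7 p. 48 = Thm 4.1 for all `T` and the
  intersection of the scale): smooth data with Clay decay (4.39) = Clay (4), smooth force with
  (4.40) = Clay (5), `div u₀ = 0` ⇒ a UNIQUE pair `(u,p) ∈ C^∞([0,∞)×ℝ³)²` solving NS (4.36), with
  the energy estimate (4.38). Typed CONCRETELY in the tree's Clay vocabulary; the passage
  Thm 4.1 (all `T,k,s`) ⇒ Thm 4.7 ⇒ Cor 4.8 is bookkeeping over the (untyped) scale and is not typed.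
* HEADLINE = `ClaimedTheorem` := `∀ μ > 0, Corollary48 μ` (the checkable payoff "uniqueness and
  existence theorem for smooth solutions … for smooth data with a prescribed asymptotic behaviour",
  abstract of the paper); `clay_of_claimed` PROVES `ClaimedTheorem → clayR3.ForcedRegularityAt μ ∧
  clayR3.RegularityAt μ` for every `μ > 0` — NO Clay delta (ℝ³, data (4), force (5) ⊇ `f ≡ 0`,
  `C^∞` on `[0,∞)`, bounded energy from (4.38)); IF the steps held, C16 would settle Clay (A) and
  refute (C).
* Typist's flags for the refuter/referee (not a verdict): (i) Step 3a as printed is an inference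
  between reals whose valid form carries the coefficient `(10²Q)^{−1/(2r_j)} → 1`, not `1/(10²Q)`;
  the absorption (3.16)–(3.21) uses the small coefficient `1/Q`; (ii) the display (3.13) omits the
  `L^{2(2r_j−1)}` term of (3.10), which the summation p. 34 l. −6 ff. carries again (typed with both
  terms, the form used downstream); (iii) Cor. 4.8's uniqueness clause is printed in bare
  `C^∞([0,∞)×ℝ³) × C^∞([0,∞)×ℝ³)` (no decay class), where `(u, p + c(t))` is a second solution.
-/

noncomputable section

open Set Function MeasureTheory
open scoped Topology ENNReal ContDiff

namespace Literature.Claims.NS.ShlapunovTarkhanov2020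

open Literature.Analysis.FluidPDE

/-! ### The abstract frame (§2, §4): `X` = `𝔅_vel × 𝔅_pre`, `Y` = `𝔅_for × H_{2s+k}`, `A` = (2.59) -/

section Frame

variable {X Y : Type*} [NormedAddCommGroup X] [NormedAddCommGroup Y] [NormedSpace ℝ Y]

/-- **Instantiation predicate**: `A : X → Y` is the Navier–Stokes data map (2.59) for viscosity `μ` on
`I = [0,T]` — every domain element `x` (read out as a velocity field `vel x` and a pressure `pre x`)
is a classical solution on `[0,T]` of NS with the force `frc (A x)` and initial datum `ini (A x)` read
out from its image ("(0.1) induces … the mapping `A(u,p) = (f,u₀)`", p. 28). The scale's own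
definition (§1, pp. 3–11) is not typed; this predicate records only what ties `A` to NS.
[claim: ShlapunovTarkhanov2020NSR3Withdrawn, status: disputed] -/
def IsNSDataMap (μ T : ℝ) (A : X → Y)
    (vel : X → ℝ → EuclideanSpace ℝ (Fin 3) → EuclideanSpace ℝ (Fin 3))
    (pre : X → ℝ → EuclideanSpace ℝ (Fin 3) → ℝ)
    (frc : Y → ℝ → EuclideanSpace ℝ (Fin 3) → EuclideanSpace ℝ (Fin 3))
    (ini : Y → EuclideanSpace ℝ (Fin 3) → EuclideanSpace ℝ (Fin 3)) : Prop :=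
  ∀ x : X, IsClassicalNSSolutionOn (Icc 0 T) μ (frc (A x)) (vel x) (pre x) ∧ vel x 0 = ini (A x)

/-- **Step 1 — Theorem 2.11 (p. 28)**: "(0.1) induces an injective continuous nonlinear mapping
`A : 𝔅^{k,2s,s}_vel × 𝔅^{k+1,2(s−1),s−1}_pre → 𝔅^{k,2(s−1),s−1}_for × H_{2s+k}` which is moreover open"
(proof: Lemma 2.7 continuity; Thm 1.8 uniqueness; Thm 2.9 invertible Fréchet derivative + the
implicit function theorem). [claim: ShlapunovTarkhanov2020NSR3Withdrawn, status: disputed] -/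
def Theorem211 (A : X → Y) : Prop :=
  Continuous A ∧ Function.Injective A ∧ IsOpenMap A

/-- **Step 2 — Corollary 2.12 (p. 28)**: "The range of the mapping (2.59) is closed if and only if it
coincides with the whole destination space" (clopen sets in a connected space).
[claim: ShlapunovTarkhanov2020NSR3Withdrawn, status: disputed] -/
def Corollary212 (A : X → Y) : Prop :=
  IsClosed (range A) ↔ range A = univ

/-- Step 2 is a theorem given Step 1's openness: a real normed space is (path-)connected, the range
of an open map is open, and a nonempty clopen set is everything.
[cite: ShlapunovTarkhanov2020NSR3Withdrawn, Cor. 2.12 p.28] -/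
theorem corollary212_of_isOpenMap (A : X → Y) (hA : IsOpenMap A) : Corollary212 A := by
  refine ⟨fun hc => ?_, fun h => h ▸ isClosed_univ⟩
  exact IsClopen.eq_univ ⟨hc, hA.isOpen_range⟩ (range_nonempty A)

/-- **Step 3 — Theorem 3.1 (p. 29), the load-bearing lemma** ("a property similar to the
properness"): "Let `s ∈ ℕ`, `k ∈ ℤ₊` and `r > 3`. If `S = S_vel × S_pre` is a subset of
`𝔅_vel × 𝔅_pre` such that the image `A(S)` is precompact in `𝔅_for × H_{2s+k}`, then the set `S_vel`
is bounded in the space `C(I, L^r(ℝ³))`." Typed over the frame with the velocity read-out `vel`: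
precompact image ⇒ a uniform bound on `‖vel x (t)‖_{L^r(ℝ³)}`, `x ∈ S`, `t ∈ [0,T]`. Its printed
proof (pp. 29–38) passes through `Ineq313Inference`.
[claim: ShlapunovTarkhanov2020NSR3Withdrawn, status: disputed] -/
def Theorem31 (T : ℝ) (A : X → Y)
    (vel : X → ℝ → EuclideanSpace ℝ (Fin 3) → EuclideanSpace ℝ (Fin 3)) (r : ℝ) : Prop :=
  ∀ S : Set X, (∃ K : Set Y, IsCompact K ∧ A '' S ⊆ K) →
    ∃ M : ℝ≥0∞, M < ⊤ ∧ ∀ x ∈ S, ∀ t ∈ Icc 0 T, eLpNorm (vel x t) (ENNReal.ofReal r) volume ≤ M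

/-- **Step 4 — §4, Lemmas 4.2–4.5 and Corollary 4.6 (pp. 39–47)**: from the `C(I,L^r(ℝ³))` bounds of
Theorem 3.1 (all `r > 3`; used with Prodi–Serrin-type criteria and a priori estimates "slightly
different from the standard ones", Lemma 4.2 p. 39) the range of `A` is closed (the closedness
half of the proof of Thm 4.1, pp. 39–47). [claim: ShlapunovTarkhanov2020NSR3Withdrawn, status: disputed] -/
def ClosedRangeOfTheorem31 (T : ℝ) (A : X → Y)
    (vel : X → ℝ → EuclideanSpace ℝ (Fin 3) → EuclideanSpace ℝ (Fin 3)) : Prop :=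
  (∀ r : ℝ, 3 < r → Theorem31 T A vel r) → IsClosed (range A)

/-- **Step 5 — Theorem 4.1 (p. 39), the main theorem**: "Let `k ∈ ℤ₊`, `s ∈ ℕ`. Then for each `T > 0`
mapping (2.59) generated by the Navier–Stokes equations of (0.1) is a homeomorphism" (the energy
estimate clause is Lemma 3.2 and is not retyped). [claim: ShlapunovTarkhanov2020NSR3Withdrawn, status: disputed] -/
def Theorem41 (A : X → Y) : Prop :=
  ∃ e : X ≃ₜ Y, ⇑e = A

/-- **Composition of the abstract chain (pure logic + Step 2)**: Step 1 (continuous, injective, open)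
→ Step 3 (Thm 3.1 for all `r > 3`) → Step 4 (closed range) → Step 5 (homeomorphism): closed and
open range ⇒ onto (Cor. 2.12), and a continuous open bijection is a homeomorphism — exactly the
proof of Thm 4.1 printed on p. 47 ("Theorem 2.11, Corollary 2.12 and Corollary 4.6").
[claim: ShlapunovTarkhanov2020NSR3Withdrawn, status: disputed] -/
theorem theorem41_of_steps (T : ℝ) (A : X → Y)
    (vel : X → ℝ → EuclideanSpace ℝ (Fin 3) → EuclideanSpace ℝ (Fin 3))
    (h1 : Theorem211 A) (h3 : ∀ r : ℝ, 3 < r → Theorem31 T A vel r)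
    (h4 : ClosedRangeOfTheorem31 T A vel) : Theorem41 A := by
  obtain ⟨hcont, hinj, hopen⟩ := h1
  have hsurj : Function.Surjective A :=
    Set.range_eq_univ.mp ((corollary212_of_isOpenMap A hopen).mp (h4 h3))
  exact ⟨(Equiv.ofBijective A ⟨hinj, hsurj⟩).toHomeomorphOfContinuousOpen hcont hopen, rfl⟩

end Frame

/-! ### Step 3a — the decisive inference inside the proof of Theorem 3.1 (p. 34), abstract grain -/

/-- **Step 3a — "(3.10) implies (3.13)" (p. 34 l. 1–9), as an inference between nonnegative reals.**
(3.10) (Lemma 3.4, p. 32), for every `t ∈ [0,T]`, `Q > 0`, `r > 3/2`: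
`‖u(t)‖_{L^{2r}}^{2r} + (dissipation ≥ 0) ≤ ‖u₀‖_{L^{2r}}^{2r} + b + c + (1/(10²Q))·(‖u‖_{L^{4r}(I,L^{4r})}^{16r²/(8r−1)} + ‖u‖_{L^{2(2r−1)}(I,L^{2(2r−1)})}^{16r²/(8r−1)})`
with the data terms `b = (5/(8r))(C r Q^{…}‖f‖_{L²L²})^{16r²/(10r−1)}`, `c = (1/(8r))(C r Q^{8r/(8r−1)}‖(f,u₀)‖_{0,μ,T})^{8r}`;
(3.13) (p. 34, with `R_j(f,u₀,Q) = ‖u₀‖_{L^{2r_j}} + b^{1/(2r_j)} + c^{1/(2r_j)}` as displayed):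
`‖u‖_{C(I,L^{2r_j})} ≤ (1/(10²Q))·‖u‖_{L^{4r_j}(I,L^{4r_j})}^{8r_j/(8r_j−1)} + R_j(f,u₀,Q)` (the
`L^{2(2r_j−1)}` term, omitted in the display (3.13), is carried again in the summation p. 34 l. −6 ff.;
typed here WITH both terms, the form used downstream). Variables: `x = ‖u‖_{C(I,L^{2r})}` (sup over
`t` of the left side), `a = ‖u₀‖_{L^{2r}}`, `b, c` the data terms, `y₁, y₂` the two mixed norms.
[claim: ShlapunovTarkhanov2020NSR3Withdrawn, status: disputed] -/
def Ineq313Inference : Prop :=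
  ∀ r Q x a b c y₁ y₂ : ℝ, 3 / 2 < r → 0 < Q → 0 ≤ x → 0 ≤ a → 0 ≤ b → 0 ≤ c → 0 ≤ y₁ → 0 ≤ y₂ →
    x ^ (2 * r) ≤ a ^ (2 * r) + b + c +
        1 / (10 ^ 2 * Q) * (y₁ ^ (16 * r ^ 2 / (8 * r - 1)) + y₂ ^ (16 * r ^ 2 / (8 * r - 1))) →
    x ≤ 1 / (10 ^ 2 * Q) * (y₁ ^ (8 * r / (8 * r - 1)) + y₂ ^ (8 * r / (8 * r - 1))) +
        (a + b ^ (1 / (2 * r)) + c ^ (1 / (2 * r)))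

/-! ### Step 6 and the headline — Corollary 4.8 (p. 48) in the Clay vocabulary -/

/-- **Step 6 — Corollary 4.8 (p. 48), existence part**: "Let `(f,u₀) ∈ C^∞(ℝ³×[0,+∞)) × C^∞(ℝ³) ∩ ker(div)`
satisfy (4.39) `|∂^α u₀(x)| ≤ c_{α,k}(1+|x|)^{−k}` [= Clay (4)] and (4.40)
`|∂^α_x ∂^m_t f(x,t)| ≤ c_{α,m,k}(1+|x|+t)^{−k}` [= Clay (5)]. Then there is a … pair `(u,p)` in
`C^∞([0,+∞)×ℝ³) × C^∞([0,+∞)×ℝ³)` satisfying the Navier–Stokes equations (4.36) [viscosity `μ`].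
Moreover, the energy estimate (4.38) holds true" — (4.38) `sup_t ‖u(t)‖²_{L²} + μ∫₀^∞‖∇u‖²_{L²} ≤
(1+2√2)‖(f,u₀)‖²_{0,μ,∞}` is typed by its consequence Clay (7) `HasBoundedEnergy u` (the explicit
constant is not typed). [claim: ShlapunovTarkhanov2020NSR3Withdrawn, status: disputed] -/
def Corollary48Existence (μ : ℝ) : Prop :=
  ∀ (u₀ : EuclideanSpace ℝ (Fin 3) → EuclideanSpace ℝ (Fin 3))
    (f : ℝ → EuclideanSpace ℝ (Fin 3) → EuclideanSpace ℝ (Fin 3)),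
    ContDiff ℝ ∞ u₀ → NSWave0.IsDivFree u₀ → HasRapidSpatialDecay u₀ →
    IsSmoothOnHalfSpace f → HasRapidSpaceTimeDecay f →
      ∃ (u : ℝ → EuclideanSpace ℝ (Fin 3) → EuclideanSpace ℝ (Fin 3))
        (p : ℝ → EuclideanSpace ℝ (Fin 3) → ℝ),
        IsSmoothOnHalfSpace u ∧ IsSmoothOnHalfSpace p ∧ IsNavierStokesSolution μ f u₀ u p ∧
          HasBoundedEnergy u

/-- **Step 6 — Corollary 4.8 (p. 48), uniqueness part AS PRINTED**: "there is a UNIQUE pair `(u,p)` in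
the space `C^∞([0,+∞)×ℝ³) × C^∞([0,+∞)×ℝ³)` satisfying the Navier–Stokes equations (4.36)" — in
the bare smooth class, no decay or energy condition on the competitor (Thm 4.7's uniqueness is in
the scale `𝔅^{∞,∞}`; the corollary prints it in `C^∞`). [claim: ShlapunovTarkhanov2020NSR3Withdrawn, status: disputed] -/
def Corollary48Uniqueness (μ : ℝ) : Prop :=
  ∀ (u₀ : EuclideanSpace ℝ (Fin 3) → EuclideanSpace ℝ (Fin 3))
    (f : ℝ → EuclideanSpace ℝ (Fin 3) → EuclideanSpace ℝ (Fin 3)),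
    ContDiff ℝ ∞ u₀ → NSWave0.IsDivFree u₀ → HasRapidSpatialDecay u₀ →
    IsSmoothOnHalfSpace f → HasRapidSpaceTimeDecay f →
      ∀ (u u' : ℝ → EuclideanSpace ℝ (Fin 3) → EuclideanSpace ℝ (Fin 3))
        (p p' : ℝ → EuclideanSpace ℝ (Fin 3) → ℝ),
        IsSmoothOnHalfSpace u → IsSmoothOnHalfSpace p → IsNavierStokesSolution μ f u₀ u p →
        IsSmoothOnHalfSpace u' → IsSmoothOnHalfSpace p' → IsNavierStokesSolution μ f u₀ u' p' →
          u' = u ∧ p' = p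

/-- **Step 6 — Corollary 4.8 (p. 48) as printed**: existence (with the energy estimate) and uniqueness.
[claim: ShlapunovTarkhanov2020NSR3Withdrawn, status: disputed] -/
def Corollary48 (μ : ℝ) : Prop :=
  Corollary48Existence μ ∧ Corollary48Uniqueness μ

/-- **HEADLINE** — the paper's payoff for "smooth data with a prescribed asymptotic behaviour at
infinity" (abstract; Cor. 4.8 p. 48) at every viscosity `μ > 0` (the paper's `μ` is an arbitrary
positive constant, (0.1) p. 1). [claim: ShlapunovTarkhanov2020NSR3Withdrawn, status: disputed] -/
def ClaimedTheorem : Prop :=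
  ∀ μ : ℝ, 0 < μ → Corollary48 μ

/-- Trivial direction of the composition: Step 6 at every `μ > 0` is the headline.
[claim: ShlapunovTarkhanov2020NSR3Withdrawn, status: disputed] -/
theorem claim_of_steps (h6 : ∀ μ : ℝ, 0 < μ → Corollary48 μ) : ClaimedTheorem := h6

/-- **Clay link, no delta**: the existence part of Cor. 4.8 at viscosity `μ` is LITERALLY forced
regularity for the `ℝ³` Clay spec (data (4), forces (5), smooth on `[0,∞)`, bounded energy (7)),
hence also Clay (A) at `μ` (`f ≡ 0` is an admissible force).
[cite: ShlapunovTarkhanov2020NSR3Withdrawn, Cor. 4.8 p.48] -/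
theorem clay_of_corollary48Existence {μ : ℝ} (h : Corollary48Existence μ) :
    ClayVariants.clayR3.ForcedRegularityAt μ ∧ ClayVariants.clayR3.RegularityAt μ := by
  have hF : ClayVariants.clayR3.ForcedRegularityAt μ :=
    fun u₀ hu₀ hdiv hdata f hf hforce => h u₀ f hu₀ hdiv hdata hf hforce
  exact ⟨hF, hF.regularityAt ClayVariants.clayR3_force_zero ClayVariants.isSmoothOnHalfSpace_zero⟩

/-- **`clay_of_claimed`**: IF the paper's steps held, Clay (A) would hold at every `μ > 0` and the
forced problem would be regular ((C) refuted at every `μ`). [cite: ShlapunovTarkhanov2020NSR3Withdrawn, Cor. 4.8 p.48] -/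
theorem clay_of_claimed (h : ClaimedTheorem) {μ : ℝ} (hμ : 0 < μ) :
    ClayVariants.clayR3.ForcedRegularityAt μ ∧ ClayVariants.clayR3.RegularityAt μ :=
  clay_of_corollary48Existence (h μ hμ).1

/-- In particular the headline gives the `ℝ³` Clay regularity statement (A) in its all-`ν` form.
[cite: ShlapunovTarkhanov2020NSR3Withdrawn, Cor. 4.8 p.48] -/
theorem clayRegularity_of_claimed (h : ClaimedTheorem) : ClayVariants.clayR3.Regularity :=
  fun _ hν => (clay_of_claimed h hν).2

end Literature.Claims.NS.ShlapunovTarkhanov2020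

end
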